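import Mathlib
import Summits.RiemannHypothesis.RiemannHypothesis.Theorems.WeilFarFloorResidualEnergyCramerTools
import Summits.RiemannHypothesis.RiemannHypothesis.Theorems.WeilFarFloorCoshZeroSum
import HarnessLib

/-!
# The residual energy of the cosh profile IS the lag-`2b` autocorrelation energy of the Cramér function (under RH)

Helper file (`--supports stmt-RiemannHypothesis-0098`, lead-track anchor: Weil-positivity window ladder, format-C far bound),
pure proofs over BUILT imports.  Seat rh-explicit-weil-1 gen16 (memo `run/shared/lean/pub/rh-explicit/rh-explicit-weil-1/FORMAT-K3.md`
§17).

Objects (all inline, as in the second-order chain `WeilFarFloorSecondOrderLawRH`/`…ExactRH`): the cosh profile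
`C_b = 1_{[−b,b]}cosh(·/2)` (`P = ∫C_b² = b + sinh b`), the prime-shift operator `T_b`, the cosh quotient `R_c(b) = Q_b(C_b)/P` and the
RESIDUAL ENERGY `J(b) = ∫_{(−b,b)}(T_bC_b − R_c(b)C_b)²/P` — under RH the coefficient of the floor gap,
`λ_max(a) = R_c(a) + (1 + o(1))J(a)/R_c(a) + o(e^{−a})`.  With the CRAMÉR FUNCTION `g(u) = e^{−u/2}(ψ(e^u) − e^u)`
(mean square `β₂ = Σ_ρ m(ρ)²/|ρ|²`, MV Thm. 13.6) and its lag-`2b` autocorrelation energy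
`Φ(b) = ∫₀^{2b} (g(u) + g(2b − u))² du`, this file proves
**`RH → ∃ C b₀, ∀ b ≥ b₀, |√J(b) − ½·√(e^b/P)·√Φ(b)| ≤ C`** (`abs_sqrt_residualEnergy_sub_le_of_RH`), i.e. `J(b) = Φ(b)/2 + O(√Φ + 1)`
(`e^b/P → 2`).  Method: the closed form `T_bC_b − (e^b + b)C_b = x sinh(x/2) + Mertens terms + O(x)`
(`FloorCoshSplit.primeShiftOp_coshProfile_sub_eq`; RH-free tools in `WeilFarFloorResidualEnergyCramerTools`) with `O(x) = ½e^{b/2}(g(b+x) + g(b−x))`; the residual is `r = O + E` where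
`E = [x sinh(x/2) − (b−1)cosh(x/2)] + [Mertens terms] + (e^b + 2b − 1 − R_c(b))cosh(x/2)` has `∫E² ≤ 288·P` — the geometric
bracket by `(1−s)² ≤ 16e^{s/2}`, the Mertens bracket by `|Σ_{n≤y}Λ(n)/n − log y| ≤ 4` (Literature `MertensFirstUpper`, tree
`FloorCosh.vonMangoldt_div_sum_ge`), and the last by the RH floor law for the cosh quotient
`|R_c(b) − (e^b + 2b − 2 − 2γ)| ≤ β + 1` eventually (`FloorCoshZeroSum.eventually_abs_coshSum_div_sub_le_of_RH`) — then Minkowski in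
`L²(−b, b)` and `∫_{(−b,b)}O² = (e^b/4)Φ(b)`.  Consequences (successor files, with Literature `CramerMeanSquare` MV 13.6 and
`WeilFarFloorCramerPrimitiveRH`): `J(b) ≤ (4β₂ + ε)b` eventually and `(1/A²)∫₁^A J(b)db → β₂`.
Standard axioms only; RH enters as Mathlib's `RiemannHypothesis`.  Nothing here bears on the truth of RH.
-/

set_option linter.dupNamespace false
set_option autoImplicit false

noncomputable section

open MeasureTheory Set Filter Topology
open scoped Real BigOperators ArithmeticFunction.vonMangoldt Chebyshev

namespace Summit.RiemannHypothesis.RiemannHypothesis.Theorems.WeilFormatC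

namespace FloorResidualMean

open Literature.NumberTheory.LFunctions FloorCosh FloorCoshSplit

variable {b : ℝ}

/-! ## The main estimate: `√J(b) = ½√(e^b/P)·√Φ(b) + O(1)` under RH -/

/-- Under RH the cosh quotient obeys `|(b − 1) − (R_c(b) − e^b − b)| ≤ 4` eventually (floor law for the cosh test with the explicit
constant `β + 1`, `β < 0.0474`, `γ < 2/3`). -/
theorem eventually_abs_kappa_le_of_RH (hRH : RiemannHypothesis) :
    ∀ᶠ b : ℝ in atTop, |b - 1 - (primeShiftForm b ((Icc (-b) b).indicator (fun y ↦ Real.cosh (y / 2))) / (b + Real.sinh b)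
      - Real.exp b - b)| ≤ 4 := by
  filter_upwards [FloorCoshZeroSum.eventually_abs_coshSum_div_sub_le_of_RH hRH one_pos] with b hb
  rw [← primeShiftForm_coshTest b] at hb
  have hβ := nicolasBeta_lt'
  have hγ := Real.eulerMascheroniConstant_lt_two_thirds
  have hγ0 := (Real.one_half_lt_eulerMascheroniConstant).le
  obtain ⟨h1, h2⟩ := abs_le.1 hb
  rw [abs_le]; constructor <;> linarith

/-- **THE RESIDUAL ENERGY IS THE CRAMÉR AUTOCORRELATION ENERGY** (under RH): there are `C, b₀` with
`|√J(b) − ½·√(e^b/(b + sinh b))·√Φ(b)| ≤ C` for all `b ≥ b₀`, where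
`J(b) = ∫_{(−b,b)}(T_bC_b − R_c(b)C_b)²/(b + sinh b)` is the residual energy of the cosh profile (the coefficient of the floor gap in
`WeilFarFloorSecondOrderLawRH`) and `Φ(b) = ∫₀^{2b}(g(u) + g(2b−u))² du`, `g(u) = e^{−u/2}(ψ(e^u) − e^u)` the Cramér function.
(`C = 17` works.) -/
theorem abs_sqrt_residualEnergy_sub_le_of_RH (hRH : RiemannHypothesis) :
    ∃ C b₀ : ℝ, ∀ b : ℝ, b₀ ≤ b →
      |Real.sqrt ((∫ x in Ioo (-b) b,
          ((∑ n ∈ weilPrimeIndex b, (Λ n : ℝ) / Real.sqrt n *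
              ((Icc (-b) b).indicator (fun y ↦ Real.cosh (y / 2)) (x - Real.log n)
                + (Icc (-b) b).indicator (fun y ↦ Real.cosh (y / 2)) (x + Real.log n)))
            - primeShiftForm b ((Icc (-b) b).indicator (fun y ↦ Real.cosh (y / 2))) / (b + Real.sinh b)
              * (Icc (-b) b).indicator (fun y ↦ Real.cosh (y / 2)) x) ^ 2) / (b + Real.sinh b))
        - 1 / 2 * Real.sqrt (Real.exp b / (b + Real.sinh b))
          * Real.sqrt (∫ u in (0 : ℝ)..(2 * b),
              (Real.exp (-(u / 2)) * (ψ (Real.exp u) - Real.exp u)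
                + Real.exp (-((2 * b - u) / 2)) * (ψ (Real.exp (2 * b - u)) - Real.exp (2 * b - u))) ^ 2)| ≤ C := by
  obtain ⟨a₀, ha₀⟩ := eventually_atTop.1 (eventually_abs_kappa_le_of_RH hRH)
  refine ⟨17, max a₀ 1, fun b hb ↦ ?_⟩
  have hb1 : 1 ≤ b := le_trans (le_max_right _ _) hb
  have hb0 : 0 ≤ b := by linarith
  have hκ := ha₀ b (le_trans (le_max_left _ _) hb)
  set S := Ioo (-b) b with hS
  set P := b + Real.sinh b with hP
  have hsinh : 0 ≤ Real.sinh b := Real.sinh_nonneg_iff.2 hb0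
  have hP0 : 0 < P := by rw [hP]; linarith
  set C : ℝ → ℝ := (Icc (-b) b).indicator (fun y ↦ Real.cosh (y / 2)) with hC
  set R := primeShiftForm b C / P with hR
  set r : ℝ → ℝ := fun x ↦ (∑ n ∈ weilPrimeIndex b, (Λ n : ℝ) / Real.sqrt n *
      (C (x - Real.log n) + C (x + Real.log n))) - R * C x with hr
  set O : ℝ → ℝ := fun x ↦ (Real.exp (x / 2) * (ψ (Real.exp (b - x)) - Real.exp (b - x))
      + Real.exp (-(x / 2)) * (ψ (Real.exp (b + x)) - Real.exp (b + x))) / 2 with hO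
  set E : ℝ → ℝ := fun x ↦ r x - O x with hE
  set Φ := ∫ u in (0 : ℝ)..(2 * b), (Real.exp (-(u / 2)) * (ψ (Real.exp u) - Real.exp u)
      + Real.exp (-((2 * b - u) / 2)) * (ψ (Real.exp (2 * b - u)) - Real.exp (2 * b - u))) ^ 2 with hΦ
  -- measurability and bounds
  have hrm : Measurable r := measurable_residual b R
  have hOm : Measurable O := measurable_osc b
  have hEm : Measurable E := hrm.sub hOm
  set Mr := (2 * (∑ n ∈ weilPrimeIndex b, (Λ n : ℝ) / Real.sqrt n) + |R|) * Real.cosh (b / 2) with hMr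
  set MO := Real.exp b * (ψ (Real.exp (2 * b)) + Real.exp (2 * b)) with hMO
  have hrb : ∀ x ∈ S, |r x| ≤ Mr := fun x _ ↦ FloorSecondOrder.abs_residualCore_le b R x
  have hOb : ∀ x ∈ S, |O x| ≤ MO := fun x hx ↦ abs_osc_le hx
  have hEb : ∀ x ∈ S, |E x| ≤ Mr + MO := fun x hx ↦ (abs_sub _ _).trans (add_le_add (hrb x hx) (hOb x hx))
  have hnegEm : Measurable (fun x ↦ -E x) := hEm.neg
  have hnegEb : ∀ x ∈ S, |(-E x)| ≤ Mr + MO := fun x hx ↦ by rw [abs_neg]; exact hEb x hx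
  -- integrability on the window
  have iOO : IntegrableOn (fun x ↦ O x ^ 2) S := by
    simpa only [sq] using integrableOn_window_mul hOm hOm hOb hOb
  have iOE : IntegrableOn (fun x ↦ O x * E x) S := integrableOn_window_mul hOm hEm hOb hEb
  have iEE : IntegrableOn (fun x ↦ E x ^ 2) S := by
    simpa only [sq] using integrableOn_window_mul hEm hEm hEb hEb
  have irr : IntegrableOn (fun x ↦ r x ^ 2) S := by
    simpa only [sq] using integrableOn_window_mul hrm hrm hrb hrb
  have irE : IntegrableOn (fun x ↦ r x * (-E x)) S := integrableOn_window_mul hrm hnegEm hrb hnegEb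
  have iEE' : IntegrableOn (fun x ↦ (-E x) ^ 2) S := by simpa only [neg_sq] using iEE
  -- the energy of E
  have hE2 : ∫ x in S, E x ^ 2 ≤ 288 * P := by
    have hmaj : IntegrableOn (fun x ↦ 3 * (16 * (Real.exp (b / 2) * Real.cosh (x / 2)) + 16 * Real.cosh (x / 2) ^ 2
        + (b - 1 - (R - Real.exp b - b)) ^ 2 * Real.cosh (x / 2) ^ 2)) S :=
      (Continuous.integrableOn_Icc (by fun_prop)).mono_set Ioo_subset_Icc_self
    have hle : ∫ x in S, E x ^ 2 ≤ ∫ x in S, 3 * (16 * (Real.exp (b / 2) * Real.cosh (x / 2)) + 16 * Real.cosh (x / 2) ^ 2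
        + (b - 1 - (R - Real.exp b - b)) ^ 2 * Real.cosh (x / 2) ^ 2) :=
      setIntegral_mono_on iEE hmaj measurableSet_Ioo fun x hx ↦ residual_sub_osc_sq_le R hx
    have i1 : IntegrableOn (fun x ↦ Real.exp (b / 2) * Real.cosh (x / 2)) S :=
      (Continuous.integrableOn_Icc (by fun_prop)).mono_set Ioo_subset_Icc_self
    have i2 : IntegrableOn (fun x ↦ Real.cosh (x / 2) ^ 2) S :=
      (Continuous.integrableOn_Icc (by fun_prop)).mono_set Ioo_subset_Icc_self
    have heval : ∫ x in S, 3 * (16 * (Real.exp (b / 2) * Real.cosh (x / 2)) + 16 * Real.cosh (x / 2) ^ 2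
        + (b - 1 - (R - Real.exp b - b)) ^ 2 * Real.cosh (x / 2) ^ 2)
        = 3 * (16 * (2 * (Real.exp b - 1)) + 16 * P + (b - 1 - (R - Real.exp b - b)) ^ 2 * P) := by
      have i16a : IntegrableOn (fun x ↦ 16 * (Real.exp (b / 2) * Real.cosh (x / 2))) S := i1.const_mul 16
      have i16b : IntegrableOn (fun x ↦ 16 * Real.cosh (x / 2) ^ 2) S := i2.const_mul 16
      have ik : IntegrableOn (fun x ↦ (b - 1 - (R - Real.exp b - b)) ^ 2 * Real.cosh (x / 2) ^ 2) S := i2.const_mul _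
      have iab : IntegrableOn (fun x ↦ 16 * (Real.exp (b / 2) * Real.cosh (x / 2)) + 16 * Real.cosh (x / 2) ^ 2) S :=
        i16a.add i16b
      rw [MeasureTheory.integral_const_mul (3 : ℝ), MeasureTheory.integral_add iab ik, MeasureTheory.integral_add i16a i16b,
        MeasureTheory.integral_const_mul (16 : ℝ), MeasureTheory.integral_const_mul (16 : ℝ),
        MeasureTheory.integral_const_mul ((b - 1 - (R - Real.exp b - b)) ^ 2),
        setIntegral_exp_mul_cosh_half hb0, setIntegral_cosh_half_sq hb0]
    have hexp : Real.exp b - 1 ≤ 2 * P := by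
      rw [hP, Real.sinh_eq]
      have := Real.exp_pos (-b)
      have : Real.exp (-b) ≤ 1 := by rw [Real.exp_neg]; exact inv_le_one_of_one_le₀ (Real.one_le_exp hb0)
      linarith
    have hκ2 : (b - 1 - (R - Real.exp b - b)) ^ 2 ≤ 16 := by
      obtain ⟨h1, h2⟩ := abs_le.1 hκ
      nlinarith
    rw [heval] at hle
    nlinarith [hle, hexp, hκ2, hP0]
  -- Minkowski both ways
  have hrOE : ∀ x, r x = O x + E x := fun x ↦ by simp only [hE]; ring
  have hOrE : ∀ x, O x = r x + -E x := fun x ↦ by simp only [hE]; ring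
  have hm1 : Real.sqrt (∫ x in S, r x ^ 2) ≤ Real.sqrt (∫ x in S, O x ^ 2) + Real.sqrt (∫ x in S, E x ^ 2) := by
    have := sqrt_integral_add_sq_le (μ := volume.restrict S) iOO iOE iEE
    simpa only [← hrOE] using this
  have hm2 : Real.sqrt (∫ x in S, O x ^ 2) ≤ Real.sqrt (∫ x in S, r x ^ 2) + Real.sqrt (∫ x in S, E x ^ 2) := by
    have := sqrt_integral_add_sq_le (μ := volume.restrict S) irr irE iEE'
    simpa only [← hOrE, neg_sq] using this
  have hEs : Real.sqrt (∫ x in S, E x ^ 2) ≤ Real.sqrt 288 * Real.sqrt P := by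
    rw [← Real.sqrt_mul (by norm_num)]
    exact Real.sqrt_le_sqrt hE2
  have h288 : Real.sqrt 288 < 17 := by
    rw [show (288 : ℝ) = 12 ^ 2 * 2 by norm_num, Real.sqrt_mul (by norm_num), Real.sqrt_sq (by norm_num)]
    nlinarith [Real.sq_sqrt (show (0 : ℝ) ≤ 2 by norm_num), Real.sqrt_nonneg 2]
  -- the O energy
  have hOval : ∫ x in S, O x ^ 2 = Real.exp b / 4 * Φ := setIntegral_osc_sq_eq hb0
  have hsqrtP : 0 < Real.sqrt P := Real.sqrt_pos.2 hP0
  have hJ : Real.sqrt ((∫ x in S, r x ^ 2) / P) = Real.sqrt (∫ x in S, r x ^ 2) / Real.sqrt P := Real.sqrt_div' _ hP0.le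
  have hOsqrt : Real.sqrt (∫ x in S, O x ^ 2) / Real.sqrt P = 1 / 2 * Real.sqrt (Real.exp b / P) * Real.sqrt Φ := by
    rw [hOval, Real.sqrt_mul (by positivity), Real.sqrt_div' _ hP0.le,
      show Real.exp b / 4 = (Real.exp (b / 2) / 2) ^ 2 by
        rw [div_pow, ← Real.exp_nat_mul]; ring_nf,
      Real.sqrt_sq (by positivity), show Real.exp b = Real.exp (b / 2) ^ 2 by rw [← Real.exp_nat_mul]; ring_nf,
      Real.sqrt_sq (by positivity)]
    ring
  -- conclusion
  have key : |Real.sqrt (∫ x in S, r x ^ 2) / Real.sqrt P - Real.sqrt (∫ x in S, O x ^ 2) / Real.sqrt P| ≤ 17 := by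
    rw [← sub_div, abs_div, abs_of_pos hsqrtP, div_le_iff₀ hsqrtP, abs_le]
    constructor <;> nlinarith [hm1, hm2, hEs, h288, hsqrtP, Real.sqrt_nonneg 288]
  rw [hJ, ← hOsqrt]
  exact key

end FloorResidualMean

end Summit.RiemannHypothesis.RiemannHypothesis.Theorems.WeilFormatC
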